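import Summits.AtomisticToContinuum.FouriersLaw.Theorems.PhononMeanFreePathDefs
import Summits.AtomisticToContinuum.FouriersLaw.Theorems.IncoherentChannel.Negative.HarmonicWick
import Summits.AtomisticToContinuum.FouriersLaw.Theorems.PhononMeanFreePathIncoherentChannelCommonPastBoundHelper2
import Summits.AtomisticToContinuum.FouriersLaw.Theorems.PhononMeanFreePathIncoherentChannelLightConeReduction

/-!
# The transport core of line `two-horizons-forecast-loss` is EMPTY at the harmonic corner (negative-side support)

Support lemmas for crux `PhononMeanFreePath.IncoherentChannel` (item stmt-AtomisticToContinuum-11811)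
from the standing disprover's work file `Cruxes/IncoherentChannel/Disproof.lean` §6 (gen 3), about the
open stub `stub_varianceLimit` (`∃ κ > 0, N(γ²/T²)∫₀^∞ B_N → κ`, `B_N = varianceChannel = Cov_{μ_T}(p_0²,
Var(p_N(t) | z))`), all sorry-free, no new definitions:

* `harmonic_condVar_eq_const` (Kalman filter at `lam = β = 0`): by superposition the kernel from `z` is
  the translate of the kernel from rest, so the conditional variance `K_t p_N²(z) − (K_t p_N(z))²` does
  NOT depend on `z` (landed `KernelMoments.harmonic_kernel_momentum(_sq)`);
* `varianceChannel_harmonic_eq_zero`: hence `B_N(t) = Cov_{μ_T}(p_0², const) = 0` for every `N`, `t`,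
  the transport sequence vanishes identically (`varianceSeq_harmonic_eq_zero`) and
  `stub_varianceLimit` is FALSE with `lam = β = 0` admitted (`varianceLimit_false_harmonic`,
  `varianceLimit_false_without_anharmonicity`): `0 < lam`, `0 < β` are load-bearing for the transport
  core, which carries the crux's entire harmonic obstruction (`HarmonicWick.not_crux_at_harmonic`);
* `commonPast_harmonic_eq_powerCov`, `meanChannel_integrand_harmonic_eq_zero`: at the corner
  `P_N = C_N` and, with the landed Wick identity, the mean-channel integrand `P_N − 2r_N²` vanishes
  identically as well (the split `C_N − 2r_N² = B_N + (P_N − 2r_N²)` is `0 = 0 + 0` there).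
-/

noncomputable section

open MeasureTheory Filter Topology Set
open scoped NNReal
open Literature.MathematicalPhysics.KineticTheory.HeatConduction
open Literature.Probability.Process
open Summit.AtomisticToContinuum.FouriersLaw.Theorems.PhononMeanFreePath
open Summit.AtomisticToContinuum.FouriersLaw.Theorems.IncoherentChannel.Negative.KernelMoments
  (harmonic_kernel_momentum harmonic_kernel_momentum_sq)
open Summit.AtomisticToContinuum.FouriersLaw.Theorems.IncoherentChannel.Negative.HarmonicWick
  (harmonic_wick)

namespace Summit.AtomisticToContinuum.FouriersLaw.Theorems.IncoherentChannel.Negative.VarianceLimitHarmonic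

section HarmonicVariance

variable {ω₂ γ : ℝ} (hω : 0 < ω₂) (hγ : 0 ≤ γ) {T : ℝ} (hT : 0 < T)
include hω hγ hT

/-- **Kalman at the harmonic corner**: the conditional variance of `p_N(t)` given the initial
microstate is deterministic — `K_t p_N²(z) − (K_t p_N(z))²` does not depend on `z`. [folklore] -/
theorem harmonic_condVar_eq_const (N : ℕ) (t : ℝ) (z : PhaseSpace (N + 1)) :
    (∫ y, (y.2 (Fin.last N)) ^ 2 ∂((pinnedChain ω₂ 0 0 γ).transitionKernel (N + 1) T T t.toNNReal z)) -
        fcast ω₂ 0 0 γ T N t z ^ 2 =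
      (∫ y, (y.2 (Fin.last N)) ^ 2 ∂((pinnedChain ω₂ 0 0 γ).transitionKernel (N + 1) T T t.toNNReal 0)) -
        (∫ y, y.2 (Fin.last N) ∂((pinnedChain ω₂ 0 0 γ).transitionKernel (N + 1) T T t.toNNReal 0)) ^ 2 := by
  unfold fcast
  rw [harmonic_kernel_momentum_sq hω hγ (Nat.succ_pos N) hT t.toNNReal z (Fin.last N),
    harmonic_kernel_momentum hω hγ (Nat.succ_pos N) hT t.toNNReal z (Fin.last N)]
  ring

/-- **The variance channel of the harmonic chain is EMPTY**: `B_N(t) = Cov_{μ_T}(p_0², w_t) = 0` for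
every `N`, `t` (`w_t` constant). [folklore] -/
theorem varianceChannel_harmonic_eq_zero (N : ℕ) (t : ℝ) : varianceChannel ω₂ 0 0 γ T N t = 0 := by
  set μ := (pinnedChain ω₂ 0 0 γ).gibbsMeasure (N + 1) T with hμ
  haveI : IsProbabilityMeasure μ := pinnedChain_isProbabilityMeasure_gibbsMeasure hω le_rfl le_rfl γ (N + 1) hT
  set c : ℝ := (∫ y, (y.2 (Fin.last N)) ^ 2 ∂((pinnedChain ω₂ 0 0 γ).transitionKernel (N + 1) T T t.toNNReal 0)) -
      (∫ y, y.2 (Fin.last N) ∂((pinnedChain ω₂ 0 0 γ).transitionKernel (N + 1) T T t.toNNReal 0)) ^ 2 with hc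
  have hpt : ∀ z : PhaseSpace (N + 1),
      (∫ y, (y.2 (Fin.last N)) ^ 2 ∂((pinnedChain ω₂ 0 0 γ).transitionKernel (N + 1) T T t.toNNReal z)) =
        fcast ω₂ 0 0 γ T N t z ^ 2 + c := by
    intro z
    have h := harmonic_condVar_eq_const hω hγ hT N t z
    rw [hc]
    linarith
  -- integrability of `p_0²`, `v_t²`, `p_0² v_t²` under `μ`
  have hI_p2 : Integrable (fun z : PhaseSpace (N + 1) => z.2 0 ^ 2) μ :=
    commonPastBound_integrable_momentum_pow_gibbsMeasure hω le_rfl le_rfl γ hT 0 2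
  have hI_f2 : Integrable (fun z => fcast ω₂ 0 0 γ T N t z ^ 2) μ :=
    (commonPastBound_fnorm_le hω le_rfl le_rfl hγ hT N t).1
  have hI_p2f2 : Integrable (fun z : PhaseSpace (N + 1) => z.2 0 ^ 2 * fcast ω₂ 0 0 γ T N t z ^ 2) μ := by
    have hp4 : Integrable (fun z : PhaseSpace (N + 1) => (z.2 0 ^ 2) ^ 2) μ := by
      have h := commonPastBound_integrable_momentum_pow_gibbsMeasure hω le_rfl le_rfl γ hT (0 : Fin (N + 1)) 4
      refine h.congr (Eventually.of_forall fun z => ?_)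
      simp only
      ring
    have hf4 : Integrable (fun z => (fcast ω₂ 0 0 γ T N t z ^ 2) ^ 2) μ := by
      have h := (commonPastBound_fcast_even_moment hω le_rfl le_rfl hγ hT N t 2).1
      refine h.congr (Eventually.of_forall fun z => ?_)
      simp only
      ring
    have hfm : Measurable fun z => fcast ω₂ 0 0 γ T N t z :=
      commonPastBound_measurable_fcast_right hω le_rfl le_rfl hγ (T := T) N t
    exact lightCone_integrable_mul_of_sq
      (by fun_prop : Measurable fun z : PhaseSpace (N + 1) => z.2 0 ^ 2).aestronglyMeasurable
      (hfm.pow_const 2).aestronglyMeasurable hp4 hf4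
  unfold varianceChannel powerCov commonPast
  simp_rw [hpt]
  have e1 : (fun z : PhaseSpace (N + 1) => z.2 0 ^ 2 * (fcast ω₂ 0 0 γ T N t z ^ 2 + c)) =
      fun z => z.2 0 ^ 2 * fcast ω₂ 0 0 γ T N t z ^ 2 + c * z.2 0 ^ 2 := funext fun z => by ring
  rw [e1, integral_add hI_p2f2 (hI_p2.const_mul c), integral_const_mul,
    integral_add hI_f2 (integrable_const c), integral_const, probReal_univ, one_smul]
  ring

/-- Hence the transport sequence of `stub_varianceLimit` vanishes identically at the harmonic corner.
[folklore] -/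
theorem varianceSeq_harmonic_eq_zero (N : ℕ) :
    (N : ℝ) * (γ ^ 2 / T ^ 2) * ∫ t in Ioi (0 : ℝ), varianceChannel ω₂ 0 0 γ T N t = 0 := by
  simp [varianceChannel_harmonic_eq_zero hω hγ hT]

/-- **`stub_varianceLimit` is FALSE at the harmonic corner**: no `κ > 0` is the limit of the
identically vanishing transport sequence. [folklore] -/
theorem varianceLimit_false_harmonic :
    ¬ ∃ κ : ℝ, 0 < κ ∧ Tendsto (fun N : ℕ => (N : ℝ) * (γ ^ 2 / T ^ 2) *
        ∫ t in Ioi (0 : ℝ), varianceChannel ω₂ 0 0 γ T N t) atTop (𝓝 κ) := by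
  rintro ⟨κ, hκ, hlim⟩
  have h0 : Tendsto (fun N : ℕ => (N : ℝ) * (γ ^ 2 / T ^ 2) *
      ∫ t in Ioi (0 : ℝ), varianceChannel ω₂ 0 0 γ T N t) atTop (𝓝 0) := by
    have : (fun N : ℕ => (N : ℝ) * (γ ^ 2 / T ^ 2) * ∫ t in Ioi (0 : ℝ), varianceChannel ω₂ 0 0 γ T N t) =
        fun _ => 0 := funext (varianceSeq_harmonic_eq_zero hω hγ hT)
    rw [this]
    exact tendsto_const_nhds
  exact (lt_irrefl (0 : ℝ)) ((tendsto_nhds_unique hlim h0) ▸ hκ)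

/-- At the harmonic corner the common-past part EQUALS the power covariance (`B_N ≡ 0`). [folklore] -/
theorem commonPast_harmonic_eq_powerCov (N : ℕ) (t : ℝ) :
    commonPast ω₂ 0 0 γ T N t = powerCov ω₂ 0 0 γ T N t := by
  have h := varianceChannel_harmonic_eq_zero hω hγ hT N t
  unfold varianceChannel at h
  linarith

/-- … so by the landed Wick identity the mean-channel integrand vanishes identically too:
`P_N − 2 r_N² ≡ 0` at `lam = β = 0`. [folklore] -/
theorem meanChannel_integrand_harmonic_eq_zero (N : ℕ) (t : ℝ) :
    commonPast ω₂ 0 0 γ T N t - 2 * (pairCorr ω₂ 0 0 γ T N t) ^ 2 = 0 := by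
  rw [commonPast_harmonic_eq_powerCov hω hγ hT]
  have h := harmonic_wick hω hγ hT N t
  simp only [powerCov, pairCorr, fcast] at h ⊢
  linarith

end HarmonicVariance

/-- **`0 < lam ∧ 0 < β` is load-bearing for the TRANSPORT CORE**: the lead's stub `stub_varianceLimit`
of line `two-horizons-forecast-loss` with anharmonicity allowed to vanish (`0 ≤ lam`, `0 ≤ β`) is FALSE.
[folklore] -/
theorem varianceLimit_false_without_anharmonicity :
    ¬ ∀ ω₂ lam β γ : ℝ, 0 < ω₂ → 0 ≤ lam → 0 ≤ β → 0 < γ → ∀ T : ℝ, 0 < T →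
      ∃ κ : ℝ, 0 < κ ∧ Tendsto (fun N : ℕ => (N : ℝ) * (γ ^ 2 / T ^ 2) *
        ∫ t in Ioi (0 : ℝ), varianceChannel ω₂ lam β γ T N t) atTop (𝓝 κ) := fun h =>
  varianceLimit_false_harmonic one_pos zero_le_one one_pos (h 1 0 0 1 one_pos le_rfl le_rfl one_pos 1 one_pos)

end Summit.AtomisticToContinuum.FouriersLaw.Theorems.IncoherentChannel.Negative.VarianceLimitHarmonic

end
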